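import Summits.CriticalPhenomena.SAWScalingLimit.Theorems.SAWDevelopingMapHexTightBoundaryOnFrontier
import HarnessLib

/-!
# The boundary atom of `HexTight` in degenerate geometry: domains inside the outer ball (stmt-CriticalPhenomena-5423)

Crux `Summit.CriticalPhenomena.SAWScalingLimit.Theses.SAWDevelopingMap.HexTight`, line `reversal-virgin-disc`, skeleton
r8, stub `stub_onFrontierPerShellTight` (per-shell rate-free tightness of the number of separate traversals of a thin
shell `D(x; ρ, R)` centred on the Jordan curve by the critical hexagonal SAW polyline; research-open in general).
Companion of `SAWDevelopingMapHexTightOnFrontierPerShellTight.lean` (the aspect-free and one-threshold-rate reductions).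
Here: the one geometry in which the stub holds outright, with NO probabilistic input.

* `range_toCurve_subset_of_convex` — the polyline of a non-trivial SAW of `Ω_δ` lies in every convex set containing `Ω`
  (vertices of `Ω_δ` have rescaled centres in `Ω`; the pieces are straight segments; `range_toCurve_subset_of_darts`).
* `not_hasTraversals_one_of_subset_ball` — if `Ω ⊆ ball x R` then no SAW polyline of `Ω_δ` traverses `D(x; ρ, R)`,
  `ρ < R`, even once (it never reaches distance `R` from `x`; the trivial walk is a constant curve).
* `onFrontierPerShellTight_of_subset_ball` — hence the conclusion of `stub_onFrontierPerShellTight` for every Dobrushin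
  domain with `D.carrier ⊆ ball x R` (e.g. every domain of diameter `< R` seen from a point of its curve): threshold `1`,
  every mesh, every tolerance (the traversal event is empty).

References: M. Aizenman, A. Burchard, Duke Math. J. 99 (1999) §1.b [AizenmanBurchardDuke1999];
H. Duminil-Copin, S. Smirnov, Ann. of Math. 175 (2012) §4 [DuminilCopinSmirnov2012].
-/

noncomputable section

open scoped BigOperators Classical ENNReal
open MeasureTheory Filter Topology Set Metric
open Literature.Probability.LatticeModels Literature.Probability.RandomPlanarGeometry
  Literature.Probability.RandomPlanarGeometry.SAW

namespace Summit.CriticalPhenomena.SAWScalingLimit.Theorems.HexTight.BoundaryOnFrontier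

/-- The polyline of a NON-trivial SAW of `Ω_δ` lies in every convex set containing `Ω`: its vertices are vertices of
`Ω_δ`, whose rescaled centres lie in `Ω`, and its pieces are the straight segments between consecutive ones. -/
theorem range_toCurve_subset_of_convex {Ω S : Set ℂ} (hS : Convex ℝ S) (hΩS : Ω ⊆ S) {δ : ℝ} {a b : HexVertex}
    (hab : a ≠ b) (γ : HexDomainSAW Ω δ a b) :
    Set.range (γ.walk.toCurve fun v => (δ : ℂ) * hexCenter v) ⊆ S := by
  refine range_toCurve_subset_of_darts (fun v => (δ : ℂ) * hexCenter v) γ.walk ?_ ?_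
  · cases hw : γ.walk with
    | nil => exact absurd rfl hab
    | cons h p =>
      have ha := ((embDomainGraph_adj_iff hexGraph hexCenter).1 h).2.1
      exact hΩS ((embMeshDomain_subset hexGraph hexCenter Ω δ) ha)
  · intro d _
    have hd := (embDomainGraph_adj_iff hexGraph hexCenter).1 d.adj
    exact hS.segment_subset (hΩS ((embMeshDomain_subset hexGraph hexCenter Ω δ) hd.2.1))
      (hΩS ((embMeshDomain_subset hexGraph hexCenter Ω δ) hd.2.2))

/-- **If `Ω ⊆ ball x R`, no SAW polyline of `Ω_δ` traverses `D(x; ρ, R)`** (`ρ < R`), not even once: a non-trivial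
walk stays in the open ball (convexity), the trivial walk is a constant curve. -/
theorem not_hasTraversals_one_of_subset_ball {Ω : Set ℂ} {δ : ℝ} {a b : HexVertex} {x : ℂ} {ρ R : ℝ}
    (hΩ : Ω ⊆ Metric.ball x R) (hρR : ρ < R) (γ : HexDomainSAW Ω δ a b) :
    ¬ (⟨γ.walk.toCurve fun v => (δ : ℂ) * hexCenter v⟩ : Curve ℂ).HasTraversals 1 x ρ R := by
  rintro ⟨s, t, hst, -⟩
  have h0 := hst 0
  by_cases hab : a = b
  · subst hab
    have hnil : γ.walk = SimpleGraph.Walk.nil :=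
      SimpleGraph.Walk.eq_nil_iff_nil.2 (SimpleGraph.Walk.isPath_iff_nil.1 γ.isPath)
    have hconst : ∀ u : unitInterval,
        (⟨γ.walk.toCurve fun v => (δ : ℂ) * hexCenter v⟩ : Curve ℂ) u = (δ : ℂ) * hexCenter a := by
      intro u
      show (γ.walk.toCurve fun v => (δ : ℂ) * hexCenter v) u = _
      rw [hnil]
      simp [SimpleGraph.Walk.toCurve, polyline]
    rcases h0.2 with ⟨h1, h2⟩ | ⟨h1, h2⟩ <;> rw [hconst] at h1 h2 <;> linarith
  · have hrange := range_toCurve_subset_of_convex (convex_ball x R) hΩ hab γ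
    have hmem : ∀ u : unitInterval,
        dist ((⟨γ.walk.toCurve fun v => (δ : ℂ) * hexCenter v⟩ : Curve ℂ) u) x < R :=
      fun u => Metric.mem_ball.1 (hrange ⟨u, rfl⟩)
    rcases h0.2 with ⟨-, h2⟩ | ⟨h1, -⟩
    · exact absurd (hmem _) (not_lt.2 h2)
    · exact absurd (hmem _) (not_lt.2 h1)

/-- **The stub in DEGENERATE GEOMETRY (domains inside the outer ball).** If `D.carrier ⊆ ball x R`, the conclusion of
`stub_onFrontierPerShellTight` holds with threshold `1` at every mesh and for every tolerance (the traversal event is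
empty) — a genuine special case of the boundary atom in which neither the endpoint approximation nor `x ∈ frontier` nor
`R ≤ 1` is needed. -/
theorem onFrontierPerShellTight_of_subset_ball :
    ∀ (D : DobrushinDomain) (a b : ℝ → HexVertex) (x : ℂ) (ρ R : ℝ), 0 < ρ → 4 * ρ < R →
      D.carrier ⊆ Metric.ball x R → ∀ η : ℝ,
        ∃ (k : ℕ) (δ₁ : ℝ), 0 < δ₁ ∧ ∀ δ ∈ Set.Ioc (0 : ℝ) δ₁, δ ≤ ρ →
          hexSAWLaw D.carrier δ (a δ) (b δ)
            {γ | (⟨γ.walk.toCurve fun v => (δ : ℂ) * hexCenter v⟩ : Curve ℂ).HasTraversals k x ρ R} ≤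
            ENNReal.ofReal η := by
  intro D a b x ρ R hρ h4 hD η
  refine ⟨1, 1, one_pos, fun δ _ _ => ?_⟩
  have hempty : {γ : HexDomainSAW D.carrier δ (a δ) (b δ) |
      (⟨γ.walk.toCurve fun v => (δ : ℂ) * hexCenter v⟩ : Curve ℂ).HasTraversals 1 x ρ R} = ∅ :=
    Set.eq_empty_of_forall_notMem fun γ hγ => not_hasTraversals_one_of_subset_ball hD (by linarith) γ hγ
  rw [hempty, measure_empty]
  exact bot_le

end Summit.CriticalPhenomena.SAWScalingLimit.Theorems.HexTight.BoundaryOnFrontier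

end
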